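import Mathlib

/-!
# FlatDialLemmaU — module 6 of the lens-3 g11 «FlatDial» THEOREMS package (cell decomp-qadv): LEMMA U, kernel-proved

INDEPENDENT of modules 1–5 (imports Mathlib only).  The rigid-certificate piece `W_M` of record §12 plants the framed cube-key
Maiorana–McFarland direct sum; its recovery step needs that this function has a UNIQUE `M`-subspace (Dillon: an `n/2`-dimensional
subspace on which all second derivatives vanish).  This module proves exactly that, for every number of blocks `r`.

`𝔽₈ = 𝔽₂[t]/(t³+t+1)` coded on `Fin 8` (bit `i` = coefficient of `tⁱ`; field operations by carry-less arithmetic on the codes),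
`g(x,y) = Tr(x·y³)`, and on `r` blocks `F_r(x,y) = Σ_j g(x_j, y_j)` with values in `ZMod 2`; points `P r = (Fin r → Fin 8) × (Fin r → Fin 8)`
(x-part, y-part), addition `padd` = blockwise XOR.

**`msubspace_unique`.** If `V : Finset (P r)` is closed under `padd`, has `|V| = 8^r`, and every second derivative `D_uD_vF_r`
(`u, v ∈ V`) vanishes identically, then `V = X0 = {p | p.2 = 0}`.

Proof (record NODE-g11.md §12 «Second proof», instrument K-LEMMAU2): per block the second derivative is CONSTANT (direct sum,
`block_const`); two finite block facts over `𝔽₈`, certified by `decide +kernel` (no `native_decide`): (i) constancy ⇒ `b = 0 ∨ b' = 0 ∨ b = b'`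
(`factI`, the `x`-linear coefficient `bb'(b+b')`), (ii) constancy with `b = 0` ⇒ `a = 0 ∨ b' = 0 ∨ a = b'⁴` (`factII`, the `y`-linear coefficient
`(ab')⁴ + ab'²`); then `|V| = |V_Y|·|K|` (fibres of the y-projection), `V_Y ⊆ Π_j W_j`, `K ↪ Π_j S_j` with `|W_j|·|S_j| ≤ 8` at every block and
`≤ 4` at a block where `V_Y` has a nonzero entry — so no such block exists, `V ⊆ X0`, equality by cardinality.  Bentness is not used.

References: Dillon's criterion / completed MM class [Carlet2020, Prop. 54]; cube map APN on `𝔽₂³` [Carlet2020, §11.3].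
Provenance: HOME/decomp-qadv-lens-3/g11/ (record NODE-g11.md §12, instrument/K-MSUB.md §K-LEMMAU2, leanU/).
-/

set_option linter.dupNamespace false

namespace Summit.QuantumAdvantage.QuantumAdvantage.Theorems.FlatDial.LemmaU

open Finset

/-! ## §1 `𝔽₈` on `Fin 8` -/

/-- carry-less product of two 3-bit polynomials reduced mod `t³+t+1`. -/
def mulN (a b : ℕ) : ℕ :=
  let p := (if b % 2 = 1 then a else 0) ^^^ (if b / 2 % 2 = 1 then 2 * a else 0) ^^^ (if b / 4 % 2 = 1 then 4 * a else 0)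
  let p := if p / 16 % 2 = 1 then p ^^^ 22 else p
  if p / 8 % 2 = 1 then p ^^^ 11 else p

/-- `a ↦ a²` on codes. -/
def sqN (a : ℕ) : ℕ := mulN a a
/-- `a ↦ a³` on codes. -/
def cubeN (a : ℕ) : ℕ := mulN a (sqN a)
/-- `a ↦ a⁴` on codes. -/
def p4N (a : ℕ) : ℕ := sqN (sqN a)
/-- absolute trace, read off as bit 0 (it is `{0,1}`-valued). -/
def trN (a : ℕ) : Bool := decide ((a ^^^ sqN a ^^^ p4N a) % 2 = 1)

/-- `𝔽₈` as codes. -/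
abbrev B := Fin 8

/-- blockwise addition of `𝔽₈` = XOR of codes. -/
def bx (a b : B) : B := ⟨(a.val ^^^ b.val) % 8, Nat.mod_lt _ (by norm_num)⟩
/-- `a ↦ a⁴`. -/
def p4 (a : B) : B := ⟨p4N a.val % 8, Nat.mod_lt _ (by norm_num)⟩
/-- `g(x,y) = Tr(x·y³)` as a Boolean. -/
def g8 (x y : B) : Bool := trN (mulN x.val (cubeN y.val))

/-- XOR laws on `Fin 8` (finite checks). -/
theorem bx_comm : ∀ a b : B, bx a b = bx b a := by decide +kernel
/-- FlatDialLemmaU helper `bx_assoc` (decomp-qadv land package; see the module docstring). -/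
theorem bx_assoc : ∀ a b c : B, bx (bx a b) c = bx a (bx b c) := by decide +kernel
/-- FlatDialLemmaU helper `bx_self` (decomp-qadv land package; see the module docstring). -/
theorem bx_self : ∀ a : B, bx a a = 0 := by decide +kernel
/-- FlatDialLemmaU helper `bx_zero` (decomp-qadv land package; see the module docstring). -/
theorem bx_zero : ∀ a : B, bx a 0 = a := by decide +kernel
/-- FlatDialLemmaU helper `zero_bx` (decomp-qadv land package; see the module docstring). -/
theorem zero_bx : ∀ a : B, bx 0 a = a := by decide +kernel

/-- the one-block second derivative `D_{(a,b)}D_{(a',b')} g (x,y)` as a Boolean. -/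
def d2b (a b a' b' x y : B) : Bool :=
  xor (xor (g8 x y) (g8 (bx x a) (bx y b))) (xor (g8 (bx x a') (bx y b')) (g8 (bx x (bx a a')) (bx y (bx b b'))))

/-- "`D_uD_v g` is constant on `𝔽₈²`". -/
def D2const (a b a' b' : B) : Bool :=
  (List.finRange 8).all fun x => (List.finRange 8).all fun y => d2b a b a' b' x y == d2b a b a' b' 0 0

/-- block fact (i) as one closed Boolean. -/
def checkI : Bool :=
  (List.finRange 8).all fun a => (List.finRange 8).all fun b => (List.finRange 8).all fun a' =>
    (List.finRange 8).all fun b' => (b == 0 || b' == 0 || b == b') || !D2const a b a' b'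

/-- block fact (ii) as one closed Boolean. -/
def checkII : Bool :=
  (List.finRange 8).all fun a => (List.finRange 8).all fun a' => (List.finRange 8).all fun b' =>
    (a == 0 || b' == 0 || a == p4 b') || !D2const a 0 a' b'

/-- kernel evaluation of `checkI`. -/
theorem checkI_true : checkI = true := by decide +kernel
/-- kernel evaluation of `checkII`. -/
theorem checkII_true : checkII = true := by decide +kernel

/-- ★ block fact (i): constancy of `D_{(a,b)}D_{(a',b')} g` forces `b, b'` linearly dependent. -/
theorem factI {a b a' b' : B} (h : D2const a b a' b' = true) : b = 0 ∨ b' = 0 ∨ b = b' := by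
  have H := checkI_true
  simp only [checkI, List.all_eq_true, List.mem_finRange, true_implies] at H
  have := H a b a' b'
  rw [h] at this
  simpa [Bool.or_eq_true, beq_iff_eq, or_assoc] using this

/-- ★ block fact (ii): constancy of `D_{(a,0)}D_{(a',b')} g` forces `a ∈ {0, b'⁴}` (or `b' = 0`). -/
theorem factII {a a' b' : B} (h : D2const a 0 a' b' = true) : a = 0 ∨ b' = 0 ∨ a = p4 b' := by
  have H := checkII_true
  simp only [checkII, List.all_eq_true, List.mem_finRange, true_implies] at H
  have := H a a' b'
  rw [h] at this
  simpa [Bool.or_eq_true, beq_iff_eq, or_assoc] using this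

/-! ## §2 The direct sum `F_r` and its second derivatives -/

variable {r : ℕ}

/-- points: (x-part, y-part), `r` blocks each. -/
abbrev P (r : ℕ) : Type := (Fin r → B) × (Fin r → B)

/-- blockwise addition. -/
def padd (u v : P r) : P r := (fun j => bx (u.1 j) (v.1 j), fun j => bx (u.2 j) (v.2 j))

/-- the zero point. -/
def pz : P r := (fun _ => 0, fun _ => 0)

/-- `padd` is commutative. -/
theorem padd_comm (u v : P r) : padd u v = padd v u := by
  unfold padd; ext j <;> simp [bx_comm]

/-- `padd` is associative. -/
theorem padd_assoc (u v w : P r) : padd (padd u v) w = padd u (padd v w) := by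
  unfold padd; ext j <;> simp [bx_assoc]

/-- `u + u = 0`. -/
theorem padd_self (u : P r) : padd u u = pz := by
  unfold padd pz; ext j <;> simp [bx_self]

/-- `u + 0 = u`. -/
theorem padd_pz (u : P r) : padd u pz = u := by
  unfold padd pz; ext j <;> simp [bx_zero]

/-- `(u + v) + v = u`. -/
theorem padd_padd_cancel (u v : P r) : padd (padd u v) v = u := by
  rw [padd_assoc, padd_self, padd_pz]

/-- `{0,1} ⊂ ZMod 2`. -/
def bitz (t : Bool) : ZMod 2 := if t then 1 else 0

/-- `bitz` is additive. -/
theorem bitz_xor (p q : Bool) : bitz (xor p q) = bitz p + bitz q := by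
  cases p <;> cases q <;> decide

/-- `bitz` is injective. -/
theorem bitz_injective : Function.Injective bitz := by
  intro p q h; cases p <;> cases q <;> first | rfl | exact absurd h (by decide)

/-- `g` with values in `ZMod 2`. -/
def gz (x y : B) : ZMod 2 := bitz (g8 x y)

/-- `F_r(p) = Σ_j g(x_j, y_j)`. -/
def F (p : P r) : ZMod 2 := ∑ j, gz (p.1 j) (p.2 j)

/-- one-block second derivative, `ZMod 2`-valued. -/
def d2z (a b a' b' x y : B) : ZMod 2 :=
  gz x y + gz (bx x a) (bx y b) + gz (bx x a') (bx y b') + gz (bx x (bx a a')) (bx y (bx b b'))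

/-- the `ZMod 2` and the Boolean second derivatives agree. -/
theorem d2z_eq_bitz (a b a' b' x y : B) : d2z a b a' b' x y = bitz (d2b a b a' b' x y) := by
  simp only [d2z, d2b, gz, bitz_xor]; ring

/-- `D_uD_vF_r(p)`. -/
def D2F (u v p : P r) : ZMod 2 := F p + F (padd p u) + F (padd p v) + F (padd p (padd u v))

/-- second derivatives of the direct sum split over the blocks. -/
theorem D2F_eq_sum (u v p : P r) :
    D2F u v p = ∑ j, d2z (u.1 j) (u.2 j) (v.1 j) (v.2 j) (p.1 j) (p.2 j) := by
  simp only [D2F, F, padd, d2z, ← Finset.sum_add_distrib]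

/-- the point with block `j` set to `(x,y)` and all other blocks zero. -/
def pt (j : Fin r) (x y : B) : P r := (Function.update (fun _ => 0) j x, Function.update (fun _ => 0) j y)

/-- ★ DIRECT SUM ⇒ PER-BLOCK CONSTANCY: if `D_uD_vF_r ≡ 0` then every block second derivative `D_{u_j}D_{v_j} g` is constant. -/
theorem block_const {u v : P r} (h : ∀ p, D2F u v p = 0) (j : Fin r) :
    D2const (u.1 j) (u.2 j) (v.1 j) (v.2 j) = true := by
  simp only [D2const, List.all_eq_true, List.mem_finRange, true_implies, beq_iff_eq]
  intro x y
  have h1 := h (pt j x y)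
  have h0 := h pz
  rw [D2F_eq_sum] at h1 h0
  have hsum : ∑ i, (d2z (u.1 i) (u.2 i) (v.1 i) (v.2 i) ((pt j x y).1 i) ((pt j x y).2 i)
      + d2z (u.1 i) (u.2 i) (v.1 i) (v.2 i) ((pz : P r).1 i) ((pz : P r).2 i)) = 0 := by
    rw [Finset.sum_add_distrib, h1, h0, add_zero]
  have add_self : ∀ t : ZMod 2, t + t = 0 := by decide
  have eq_of_add : ∀ s t : ZMod 2, s + t = 0 → s = t := by decide
  rw [Finset.sum_eq_single j] at hsum
  · have e := eq_of_add _ _ hsum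
    simp only [pt, pz, Function.update_self] at e
    rw [d2z_eq_bitz, d2z_eq_bitz] at e
    exact bitz_injective e
  · intro i _ hij
    simp only [pt, pz, Function.update_of_ne hij]
    exact add_self _
  · intro hj; exact absurd (Finset.mem_univ j) hj

/-! ## §3 The count -/

/-- `X₀ = {p | y-part = 0}`. -/
def X0 : Finset (P r) := univ.filter fun p => p.2 = fun _ => 0

/-- `|X0| = 8^r`. -/
theorem card_X0 : (X0 : Finset (P r)).card = 8 ^ r := by
  have : (X0 : Finset (P r)) = (univ : Finset (Fin r → B)).map ⟨fun a => (a, fun _ => 0), fun a a' h => (Prod.mk.inj h).1⟩ := by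
    ext p; simp only [X0, mem_filter, mem_univ, true_and, mem_map, Function.Embedding.coeFn_mk]
    constructor
    · intro hp; exact ⟨p.1, by ext <;> simp [hp]⟩
    · rintro ⟨a, rfl⟩; rfl
  rw [this, card_map, card_univ, Fintype.card_fun, Fintype.card_fin, Fintype.card_fin]

/-- a subset of `𝔽₈` any two of whose elements are `0` or equal has at most two elements. -/
theorem card_le_two_of_dep {W : Finset B} (h : ∀ c ∈ W, ∀ c' ∈ W, c = 0 ∨ c' = 0 ∨ c = c') : W.card ≤ 2 := by
  by_cases hW : ∃ e ∈ W, e ≠ 0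
  · obtain ⟨e, he, hne⟩ := hW
    have : W ⊆ {0, e} := by
      intro c hc
      rcases h c hc e he with h0 | h0 | h0
      · simp [h0]
      · exact absurd h0 hne
      · simp [h0]
    exact (card_le_card this).trans (Finset.card_insert_le _ _)
  · simp only [not_exists, not_and, ne_eq, not_not] at hW
    have : W ⊆ {0} := fun c hc => by simp [hW c hc]
    exact (card_le_card this).trans (by simp)

section Main

variable (V : Finset (P r))

/-- y-projection of `V`. -/
def VY : Finset (Fin r → B) := V.image Prod.snd
/-- the kernel of the y-projection inside `V`. -/
def K : Finset (P r) := V.filter fun p => p.2 = fun _ => 0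
/-- block-`j` entries of the y-projection. -/
def W (j : Fin r) : Finset B := (VY V).image fun b => b j
/-- admissible block-`j` x-entries of kernel vectors. -/
def S (j : Fin r) : Finset B := univ.filter fun a => a = 0 ∨ ∀ b ∈ VY V, b j ≠ 0 → a = p4 (b j)

variable {V}

/-- `|V| = |V_Y| · |K|`. -/
theorem card_eq_card_VY_mul_card_K (hadd : ∀ u ∈ V, ∀ v ∈ V, padd u v ∈ V) :
    V.card = (VY V).card * (K V).card := by
  rw [card_eq_sum_card_fiberwise (f := Prod.snd) (t := VY V) (fun u hu => mem_image_of_mem _ hu)]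
  have : ∀ b ∈ VY V, (V.filter fun u => u.2 = b).card = (K V).card := by
    intro b hb
    obtain ⟨u₀, hu₀, rfl⟩ := mem_image.1 hb
    symm
    refine card_nbij' (fun k => padd k u₀) (fun u => padd u u₀) ?_ ?_ ?_ ?_
    · intro k hk
      have hk' := Finset.mem_coe.1 hk
      rw [K, mem_filter] at hk'
      refine Finset.mem_coe.2 (mem_filter.2 ⟨hadd _ hk'.1 _ hu₀, ?_⟩)
      ext j; simp [padd, hk'.2, zero_bx]
    · intro u hu
      have hu' := Finset.mem_coe.1 hu
      rw [mem_filter] at hu'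
      refine Finset.mem_coe.2 ?_
      rw [K, mem_filter]
      refine ⟨hadd _ hu'.1 _ hu₀, ?_⟩
      ext j; simp [padd, hu'.2, bx_self]
    · intro k _; exact padd_padd_cancel k u₀
    · intro u _; exact padd_padd_cancel u u₀
  rw [sum_congr rfl this, sum_const, smul_eq_mul]

/-- `|W_j| ≤ 2` (block fact (i)). -/
theorem card_W_le_two (hM : ∀ u ∈ V, ∀ v ∈ V, ∀ p, D2F u v p = 0) (j : Fin r) : (W V j).card ≤ 2 := by
  apply card_le_two_of_dep
  intro c hc c' hc'
  obtain ⟨b, hb, rfl⟩ := mem_image.1 hc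
  obtain ⟨b', hb', rfl⟩ := mem_image.1 hc'
  obtain ⟨u, hu, rfl⟩ := mem_image.1 hb
  obtain ⟨v, hv, rfl⟩ := mem_image.1 hb'
  exact factI (block_const (hM u hu v hv) j)

/-- `|W_j| ≤ 1` at a block where `V_Y` has no nonzero entry. -/
theorem card_W_le_one {j : Fin r} (hj : ∀ b ∈ VY V, b j = 0) : (W V j).card ≤ 1 := by
  have : W V j ⊆ {0} := by
    intro c hc
    obtain ⟨b, hb, rfl⟩ := mem_image.1 hc
    simp [hj b hb]
  exact (card_le_card this).trans (by simp)

/-- `|S_j| ≤ 2` at a block where `V_Y` HAS a nonzero entry. -/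
theorem card_S_le_two {j : Fin r} {b : Fin r → B} (hb : b ∈ VY V) (hbj : b j ≠ 0) : (S V j).card ≤ 2 := by
  have : S V j ⊆ {0, p4 (b j)} := by
    intro a ha
    rw [S, mem_filter] at ha
    rcases ha.2 with h0 | h0
    · simp [h0]
    · simp [h0 b hb hbj]
  exact (card_le_card this).trans (Finset.card_insert_le _ _)

/-- `|S_j| ≤ 8`. -/
theorem card_S_le_eight (j : Fin r) : (S V j).card ≤ 8 := by
  calc (S V j).card ≤ (univ : Finset B).card := card_le_card (filter_subset _ _)
    _ = 8 := by simp

/-- `V_Y ⊆ Π_j W_j`, hence `|V_Y| ≤ Π_j |W_j|`. -/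
theorem card_VY_le : (VY V).card ≤ ∏ j, (W V j).card := by
  rw [← Fintype.card_piFinset]
  apply card_le_card
  intro b hb
  rw [Fintype.mem_piFinset]
  intro j
  exact mem_image_of_mem _ hb

/-- `K ↪ Π_j S_j` (block fact (ii)), hence `|K| ≤ Π_j |S_j|`. -/
theorem card_K_le (hM : ∀ u ∈ V, ∀ v ∈ V, ∀ p, D2F u v p = 0) : (K V).card ≤ ∏ j, (S V j).card := by
  rw [← Fintype.card_piFinset]
  have hinj : Set.InjOn Prod.fst (K V : Set (P r)) := by
    intro u hu u' hu' h
    rw [Finset.mem_coe, K, mem_filter] at hu hu'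
    exact Prod.ext h (hu.2.trans hu'.2.symm)
  rw [← card_image_of_injOn hinj]
  apply card_le_card
  intro a ha
  obtain ⟨u, hu, rfl⟩ := mem_image.1 ha
  rw [K, mem_filter] at hu
  rw [Fintype.mem_piFinset]
  intro j
  rw [S, mem_filter]
  refine ⟨mem_univ _, ?_⟩
  by_cases h0 : u.1 j = 0
  · exact Or.inl h0
  · refine Or.inr fun b hb hbj => ?_
    obtain ⟨v, hv, rfl⟩ := mem_image.1 hb
    have hc := block_const (hM u hu.1 v hv) j
    have hu2 : u.2 j = 0 := by rw [hu.2]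
    rw [hu2] at hc
    rcases factII hc with h | h | h
    · exact absurd h h0
    · exact absurd h hbj
    · exact h

/-- ★★ LEMMA U. -/
theorem msubspace_unique (hadd : ∀ u ∈ V, ∀ v ∈ V, padd u v ∈ V) (hM : ∀ u ∈ V, ∀ v ∈ V, ∀ p, D2F u v p = 0)
    (hcard : V.card = 8 ^ r) : V = X0 := by
  -- (1) no block of `V_Y` has a nonzero entry
  have hzero : ∀ b ∈ VY V, ∀ j, b j = 0 := by
    by_contra hne
    simp only [not_forall] at hne
    obtain ⟨b, hb, j₀, hbj⟩ := hne
    -- per-block bound `|W_j|·|S_j| ≤ 8`, and `≤ 4` at `j₀`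
    have hle : ∀ j, (W V j).card * (S V j).card ≤ (if j = j₀ then 4 else 8) := by
      intro j
      by_cases hj : ∃ b' ∈ VY V, b' j ≠ 0
      · obtain ⟨b', hb', hb'j⟩ := hj
        have := Nat.mul_le_mul (card_W_le_two hM j) (card_S_le_two hb' hb'j)
        split_ifs <;> omega
      · simp only [not_exists, not_and, ne_eq, not_not] at hj
        have hjne : j ≠ j₀ := by rintro rfl; exact hbj (hj b hb)
        rw [if_neg hjne]
        have := Nat.mul_le_mul (card_W_le_one hj) (card_S_le_eight (V := V) j)
        omega
    have hprod : V.card ≤ ∏ j, (if j = j₀ then 4 else 8 : ℕ) := by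
      rw [card_eq_card_VY_mul_card_K hadd]
      calc (VY V).card * (K V).card ≤ (∏ j, (W V j).card) * ∏ j, (S V j).card :=
            Nat.mul_le_mul card_VY_le (card_K_le hM)
        _ = ∏ j, (W V j).card * (S V j).card := (prod_mul_distrib).symm
        _ ≤ ∏ j, (if j = j₀ then 4 else 8 : ℕ) := prod_le_prod (fun j _ => Nat.zero_le _) fun j _ => hle j
    have heval : ∏ j, (if j = j₀ then 4 else 8 : ℕ) = 4 * 8 ^ (r - 1) := by
      rw [← Finset.mul_prod_erase univ _ (mem_univ j₀), if_pos rfl]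
      congr 1
      rw [prod_congr rfl fun j hj => if_neg (ne_of_mem_erase hj), prod_const, card_erase_of_mem (mem_univ _),
        card_univ, Fintype.card_fin]
    rw [hcard, heval] at hprod
    have hr : 1 ≤ r := Nat.succ_le_of_lt (Nat.lt_of_le_of_lt (Nat.zero_le _) j₀.isLt)
    have : 8 ^ r = 8 * 8 ^ (r - 1) := by
      rw [← pow_succ']; congr 1; omega
    rw [this] at hprod
    have hpos : 0 < 8 ^ (r - 1) := pow_pos (by norm_num) _
    omega
  -- (2) hence `V ⊆ X₀`, and equality by cardinality
  have hsub : V ⊆ X0 := by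
    intro u hu
    rw [X0, mem_filter]
    refine ⟨mem_univ _, ?_⟩
    ext j
    exact congrArg Fin.val (hzero u.2 (mem_image_of_mem _ hu) j)
  exact eq_of_subset_of_card_le hsub (by rw [card_X0, hcard])

end Main

end Summit.QuantumAdvantage.QuantumAdvantage.Theorems.FlatDial.LemmaU
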